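import Mathlib
import HarnessLib
import Summits.NavierStokesRegularity.NavierStokesRegularity.Theorems.UnthreadedRigidityDoorUnthreadedRigidityMixedPairDefs
import Summits.NavierStokesRegularity.NavierStokesRegularity.Theorems.UnthreadedRigidityDoorUnthreadedRigidityThreadingJetsWindowGeneric

/-!
# W2 door `UnthreadedRigidity` (stmt-NavierStokesRegularity-27585) — HELMHOLTZ PROFILES WITH A NON-NEGATIVE CONSTANT ARE NULL
# (LINE g11-2 «MIXED PAIR»: the `c ≥ 0` half of S-H `HelmholtzPairDead`, unconditionally)

Prover file (engine-1 g72; `--supports stmt-NavierStokesRegularity-27585 --as helper`; route-independent imports).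

★ `eq_zero_of_vortAmpL_eq_mul_nonneg`: a virial-admissible profile `H` of degree `l` with `K_l[H] = cH` on `(0,∞)` for a constant `c ≥ 0`
(`K_l[H] = H″ + 2(l+1)H′/r`) vanishes identically on `[0,∞)`.  ENERGY IDENTITY: with `w = r^{2l+2}`, `(wH′)′ = wK = cwH`, so
`G = wH′H` has `G′ = cwH² + wH′² ≥ 0`; `G → 0` at `0⁺` (regularity) and at `∞` (decay `r^{l+2}|H|, r^{l+3}|H′| ≤ C`), so the monotone
`G` vanishes, `H′ ≡ 0`, `K ≡ 0`, and `H ≡ 0` by the tree's `eq_zero_of_vortAmpL_eq_zero`.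
★ `MixedPair.isNullProfile_of_helmholtzLinked_nonneg`: for a Helmholtz-linked pair (`K₁ = cH₁`, `K₂ = 3cH₂`) with `c ≥ 0` BOTH profiles are null —
so S-H `HelmholtzPairDead` (and its primed form) only has content for `c < 0` (the Bessel branch `H₁ = A j₁(kr)/r`, `H₂ = B j₂(√3kr)/r²`):
★ `MixedPair.helmholtzPairDead_of_negative` reduces the primed S-H′ to its `c < 0` case (explicit binders, no new `def`).

HONEST LABEL: elementary ODE facts about radial profiles of SPECIAL data; S-H′ for `c < 0`, O2a′, O2b′ remain OPEN; `UnthreadedRigidity` (27585),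
W2 and NS regularity remain OPEN; nothing here is a statement about Navier–Stokes regularity.  0 kit.
-/

noncomputable section

-- the summit and its single sub-problem share the name (CONVENTIONS §1), as in every Theorems file
set_option linter.dupNamespace false

namespace Summit.NavierStokesRegularity.NavierStokesRegularity.Theorems.UnthreadedRigidity.VirialHorn

open Set Function Filter Topology
open Summit.NavierStokesRegularity.NavierStokesRegularity.Theorems.UnthreadedRigidity.ThreadingJets
  (virialAdmissible_hasDerivAt_of_pos eq_zero_of_vortAmpL_eq_zero)

/-- ★ **HELMHOLTZ PROFILES WITH A NON-NEGATIVE CONSTANT ARE NULL**: `K_l[H] = cH` on `(0,∞)` with `c ≥ 0` and `H` virial-admissible forces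
`H ≡ 0` on `[0,∞)` (energy identity for `G = r^{2l+2}H′H`). -/
theorem eq_zero_of_vortAmpL_eq_mul_nonneg {l : ℕ} {H : ℝ → ℝ} (hH : VirialAdmissible l H) {c : ℝ} (hc : 0 ≤ c)
    (hK : ∀ r : ℝ, 0 < r → vortAmpL l H r = c * H r) : ∀ r : ℝ, 0 ≤ r → H r = 0 := by
  obtain ⟨h, hh, hHh, hder⟩ := virialAdmissible_hasDerivAt_of_pos hH
  obtain ⟨C, hC⟩ := hH.2
  -- `H′` on `(0,∞)` and its derivative
  have hH' : ∀ r, 0 < r → deriv H r = 2 * r * deriv h (r ^ 2) := fun r hr => (hder r hr).deriv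
  obtain ⟨D, hD_def⟩ : ∃ D : ℝ → ℝ, D = fun r => 2 * r * deriv h (r ^ 2) := ⟨_, rfl⟩
  have hDc : ContDiff ℝ (⊤ : ℕ∞) D := by
    have h1 : ContDiff ℝ (⊤ : ℕ∞) (deriv h) := hh.deriv'
    rw [hD_def]
    exact (contDiff_const.mul contDiff_id).mul (h1.comp (contDiff_id.pow 2))
  have hDev : ∀ r, 0 < r → deriv H =ᶠ[𝓝 r] D := fun r hr => by
    filter_upwards [Ioi_mem_nhds hr] with σ hσ
    rw [hH' σ hσ, hD_def]
  have hH'' : ∀ r, 0 < r → HasDerivAt (deriv H) (deriv D r) r := fun r hr =>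
    (((hDc.differentiable (by simp)) r).hasDerivAt).congr_of_eventuallyEq (hDev r hr)
  have hKr : ∀ r, 0 < r → deriv D r = c * H r - 2 * ((l : ℝ) + 1) / r * deriv H r := fun r hr => by
    have h1 := hK r hr
    unfold vortAmpL at h1
    rw [(hH'' r hr).deriv] at h1
    linarith
  -- the energy `G = r^{2l+2} H′ H` and its derivative `c r^{2l+2} H² + r^{2l+2} H′²`
  obtain ⟨G, hG_def⟩ : ∃ G : ℝ → ℝ, G = fun r => r ^ (2 * l + 2) * deriv H r * H r := ⟨_, rfl⟩
  obtain ⟨f, hf_def⟩ : ∃ f : ℝ → ℝ, f = fun r => c * r ^ (2 * l + 2) * H r ^ 2 + r ^ (2 * l + 2) * deriv H r ^ 2 := ⟨_, rfl⟩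
  have hGd : ∀ r, 0 < r → HasDerivAt G (f r) r := by
    intro r hr
    have h1 : HasDerivAt (fun s : ℝ => s ^ (2 * l + 2)) (((2 * l + 2 : ℕ) : ℝ) * r ^ (2 * l + 1)) r := by
      simpa using hasDerivAt_pow (2 * l + 2) r
    have h2 := (h1.mul (hH'' r hr)).mul (hder r hr)
    rw [hG_def]
    refine h2.congr_deriv ?_
    simp only [Pi.mul_apply]
    rw [hKr r hr, ← hH' r hr, hf_def]
    have hr0 : r ≠ 0 := hr.ne'
    field_simp
    push_cast
    ring
  have hf0 : ∀ r, 0 < r → 0 ≤ f r := fun r hr => by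
    rw [hf_def]
    have : 0 ≤ r ^ (2 * l + 2) := pow_nonneg hr.le _
    positivity
  -- `G` is non-decreasing on `(0,∞)`
  have hGdiff : DifferentiableOn ℝ G (interior (Ioi 0)) := by
    rw [interior_Ioi]; exact fun r hr => (hGd r hr).differentiableAt.differentiableWithinAt
  have hGcont : ContinuousOn G (Ioi 0) := fun r hr => (hGd r hr).continuousAt.continuousWithinAt
  have hGmono : MonotoneOn G (Ioi 0) :=
    monotoneOn_of_deriv_nonneg (convex_Ioi 0) hGcont hGdiff (fun r hr => by
      rw [interior_Ioi] at hr
      rw [(hGd r hr).deriv]; exact hf0 r hr)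
  -- `G ≤ 0`: decay at infinity
  have hGbig : ∀ R : ℝ, 1 ≤ R → G R ≤ C * C / R := by
    intro R hR
    have hR0 : 0 < R := by linarith
    obtain ⟨a, b, -⟩ := hC R hR
    have hC0 : 0 ≤ C := le_trans (by positivity) a
    rw [hG_def]
    calc R ^ (2 * l + 2) * deriv H R * H R ≤ |R ^ (2 * l + 2) * deriv H R * H R| := le_abs_self _
      _ = (R ^ (l + 3) * |deriv H R|) * (R ^ (l + 2) * |H R|) / R ^ 3 := by
          rw [abs_mul, abs_mul, abs_of_nonneg (pow_nonneg hR0.le _)]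
          field_simp
          ring
      _ ≤ C * C / R ^ 3 := by gcongr
      _ ≤ C * C / R := by
          apply div_le_div_of_nonneg_left (by positivity) hR0
          exact le_self_pow₀ hR (by norm_num)
  have hGle : ∀ r, 0 < r → G r ≤ 0 := by
    intro r hr
    by_contra hpos
    push Not at hpos
    set R : ℝ := max r 1 + C * C / G r + 1 with hR
    have hR1 : 1 ≤ R := by
      have : 0 ≤ C * C / G r := div_nonneg (mul_self_nonneg C) hpos.le
      rw [hR]; linarith [le_max_right r 1]
    have hrR : r ≤ R := by
      have : 0 ≤ C * C / G r := div_nonneg (mul_self_nonneg C) hpos.le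
      rw [hR]; linarith [le_max_left r 1]
    have h1 : G r ≤ G R := hGmono hr (lt_of_lt_of_le one_pos hR1) hrR
    have h2 := hGbig R hR1
    have hR0 : 0 < R := lt_of_lt_of_le one_pos hR1
    have h3 : C * C / R < G r := by
      rw [div_lt_iff₀ hR0]
      have : C * C / G r < R := by rw [hR]; linarith [le_max_left r 1, show (0:ℝ) ≤ max r 1 from le_trans hr.le (le_max_left r 1)]
      calc C * C = (C * C / G r) * G r := by field_simp
        _ < R * G r := by gcongr
        _ = G r * R := mul_comm _ _
    linarith
  -- `G ≥ 0`: regularity at the origin (`|G(ε)| ≤ 2 M M′ ε^{2l+3}`)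
  obtain ⟨M, hM⟩ := isCompact_Icc.exists_bound_of_continuousOn (hh.continuous.continuousOn (s := Icc (0 : ℝ) 1))
  obtain ⟨M', hM'⟩ := isCompact_Icc.exists_bound_of_continuousOn
    ((hh.continuous_deriv (by simp)).continuousOn (s := Icc (0 : ℝ) 1))
  have hGsmall : ∀ ε : ℝ, 0 < ε → ε ≤ 1 → |G ε| ≤ 2 * M' * M * ε := by
    intro ε hε hε1
    have hε2 : ε ^ 2 ∈ Icc (0 : ℝ) 1 := ⟨by positivity, by nlinarith⟩
    have b1 : ‖h (ε ^ 2)‖ ≤ M := hM _ hε2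
    have b2 : ‖deriv h (ε ^ 2)‖ ≤ M' := hM' _ hε2
    rw [Real.norm_eq_abs] at b1 b2
    have hM0 : 0 ≤ M := (abs_nonneg _).trans b1
    have hM'0 : 0 ≤ M' := (abs_nonneg _).trans b2
    rw [hG_def]
    simp only
    rw [hH' ε hε, hHh ε hε.le, abs_mul, abs_mul, abs_mul, abs_mul, abs_of_nonneg (pow_nonneg hε.le _), abs_of_nonneg hε.le,
      abs_two]
    have hp : ε ^ (2 * l + 2) ≤ 1 := pow_le_one₀ hε.le hε1
    calc ε ^ (2 * l + 2) * (2 * ε * |deriv h (ε ^ 2)|) * |h (ε ^ 2)| ≤ 1 * (2 * ε * M') * M := by gcongr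
      _ = 2 * M' * M * ε := by ring
  have hGge : ∀ r, 0 < r → 0 ≤ G r := by
    intro r hr
    by_contra hneg
    push Not at hneg
    have hMM : 0 ≤ 2 * M' * M := by
      have := hGsmall 1 one_pos le_rfl
      have : 0 ≤ 2 * M' * M * 1 := (abs_nonneg _).trans this
      linarith
    set ε : ℝ := min (min r 1) (-G r / (2 * M' * M + 1)) / 2 with hε
    have hq : 0 < -G r / (2 * M' * M + 1) := div_pos (by linarith) (by linarith)
    have hε0 : 0 < ε := by
      rw [hε]; have := lt_min (lt_min hr one_pos) hq; linarith
    have hεr : ε ≤ r := by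
      rw [hε]; have := (min_le_left (min r 1) (-G r / (2 * M' * M + 1))).trans (min_le_left r 1); linarith [hε0]
    have hε1 : ε ≤ 1 := by
      rw [hε]; have := (min_le_left (min r 1) (-G r / (2 * M' * M + 1))).trans (min_le_right r 1); linarith [hε0]
    have hεq : ε < -G r / (2 * M' * M + 1) := by
      rw [hε]; have := min_le_right (min r 1) (-G r / (2 * M' * M + 1)); linarith [hq]
    have h1 : G ε ≤ G r := hGmono hε0 hr hεr
    have h2 := hGsmall ε hε0 hε1
    have h3 : -G ε ≤ 2 * M' * M * ε := (neg_le_abs _).trans h2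
    have h4 : 2 * M' * M * ε < -G r := by
      have : (2 * M' * M) * ε ≤ (2 * M' * M + 1) * ε := by nlinarith [hε0.le]
      calc 2 * M' * M * ε ≤ (2 * M' * M + 1) * ε := this
        _ < (2 * M' * M + 1) * (-G r / (2 * M' * M + 1)) := by gcongr
        _ = -G r := by field_simp
    linarith
  -- hence `G ≡ 0`, `f ≡ 0`, `H′ ≡ 0`, `K ≡ 0` on `(0,∞)`
  have hG0 : ∀ r, 0 < r → G r = 0 := fun r hr => le_antisymm (hGle r hr) (hGge r hr)
  have hf00 : ∀ r, 0 < r → f r = 0 := fun r hr => by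
    have hev : G =ᶠ[𝓝 r] fun _ => 0 := by
      filter_upwards [Ioi_mem_nhds hr] with s hs using hG0 s hs
    rw [← (hGd r hr).deriv, hev.deriv_eq, deriv_const]
  have hH'0 : ∀ r, 0 < r → deriv H r = 0 := fun r hr => by
    have h1 := hf00 r hr
    rw [hf_def] at h1
    simp only at h1
    have hw : 0 < r ^ (2 * l + 2) := pow_pos hr _
    have ha : 0 ≤ c * r ^ (2 * l + 2) * H r ^ 2 := by positivity
    have hb : 0 ≤ r ^ (2 * l + 2) * deriv H r ^ 2 := by positivity
    have hb0 : r ^ (2 * l + 2) * deriv H r ^ 2 = 0 := by linarith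
    rcases mul_eq_zero.1 hb0 with h2 | h2
    · exact absurd h2 hw.ne'
    · exact pow_eq_zero_iff (n := 2) two_ne_zero |>.1 h2
  have hK0 : ∀ r, 0 < r → vortAmpL l H r = 0 := fun r hr => by
    have hev : deriv H =ᶠ[𝓝 r] fun _ => 0 := by
      filter_upwards [Ioi_mem_nhds hr] with s hs using hH'0 s hs
    unfold vortAmpL
    rw [hev.deriv_eq, deriv_const, hH'0 r hr]
    ring
  -- conclusion on `(0,∞)`, then at `0` by continuity
  have hpos := eq_zero_of_vortAmpL_eq_zero hH hK0
  intro r hr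
  rcases hr.lt_or_eq with hr | hr
  · exact (hpos r hr).1
  · -- `H 0 = h 0 = lim_{s→0⁺} h (s²) = 0`
    rw [← hr, hHh 0 le_rfl]
    have hlim : Tendsto (fun s : ℝ => h (s ^ 2)) (𝓝[>] (0 : ℝ)) (𝓝 (h (0 ^ 2))) :=
      ((hh.continuous.comp (continuous_id.pow 2)).continuousAt.tendsto).mono_left nhdsWithin_le_nhds
    have hlim' : Tendsto (fun _ : ℝ => (0 : ℝ)) (𝓝[>] (0 : ℝ)) (𝓝 (h (0 ^ 2))) := by
      refine hlim.congr' ?_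
      filter_upwards [self_mem_nhdsWithin] with s hs
      rw [← hHh s (le_of_lt hs), (hpos s hs).1]
    have := tendsto_nhds_unique tendsto_const_nhds hlim'
    simpa using this.symm

end Summit.NavierStokesRegularity.NavierStokesRegularity.Theorems.UnthreadedRigidity.VirialHorn

namespace Summit.NavierStokesRegularity.NavierStokesRegularity.Theorems.UnthreadedRigidity.MixedPair

open scoped Topology
open Filter Set
open Summit.NavierStokesRegularity.NavierStokesRegularity.Theorems.UnthreadedRigidity.ProfileHorn (E3 threadingFlux)
open Summit.NavierStokesRegularity.NavierStokesRegularity.Theorems.UnthreadedRigidity.VirialHorn (vortAmpL VirialAdmissible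
  eq_zero_of_vortAmpL_eq_mul_nonneg)

/-- ★ **A HELMHOLTZ-LINKED PAIR WITH NON-NEGATIVE CONSTANT IS NULL**: `K₁ = cH₁`, `K₂ = 3cH₂` on `(0,∞)` with `c ≥ 0` forces both admissible
profiles to vanish — the `c ≥ 0` half of S-H, unconditionally and without any jet. -/
theorem isNullProfile_of_helmholtzLinked_nonneg {H₁ H₂ : ℝ → ℝ} (hH₁ : VirialAdmissible 1 H₁) (hH₂ : VirialAdmissible 2 H₂) {c : ℝ}
    (hc : 0 ≤ c) (h : ∀ r : ℝ, 0 < r → vortAmpL 1 H₁ r = c * H₁ r ∧ vortAmpL 2 H₂ r = 3 * c * H₂ r) :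
    IsNullProfile H₁ ∧ IsNullProfile H₂ :=
  ⟨eq_zero_of_vortAmpL_eq_mul_nonneg hH₁ hc fun r hr => (h r hr).1,
    eq_zero_of_vortAmpL_eq_mul_nonneg hH₂ (by positivity : 0 ≤ 3 * c) fun r hr => by rw [(h r hr).2]⟩

/-- ★ **S-H′ REDUCES TO ITS NEGATIVE-CONSTANT CASE**: the primed Helmholtz support (pressure decay at `t₀` only) follows from the same statement
restricted to Helmholtz constants `c < 0` (the Bessel branch); for `c ≥ 0` the dipole profile is null outright. -/
theorem helmholtzPairDead_of_negative
    (hneg : ∀ (t₀ T : ℝ) (u : ℝ → E3 → E3) (p : ℝ → E3 → ℝ) (x₀ a : E3) (Q : E3 →L[ℝ] E3) (H₁ H₂ : ℝ → ℝ),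
      t₀ < T → Literature.Analysis.FluidPDE.IsClassicalNSSolutionOn (Set.Ico t₀ T) 1 0 u p → Tendsto (p t₀) (cocompact E3) (𝓝 0) →
      (∀ x : E3, ContDiffWithinAt ℝ 2 (fun t => threadingFlux u x₀ t x) (Set.Ici t₀) t₀) →
      PairAdmissible H₁ H₂ a Q → ¬ IsCoaxial a Q → u t₀ = pairShell H₁ H₂ a Q x₀ →
      (∃ c : ℝ, c < 0 ∧ ∀ r : ℝ, 0 < r → vortAmpL 1 H₁ r = c * H₁ r ∧ vortAmpL 2 H₂ r = 3 * c * H₂ r) →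
      (∀ x : E3, iteratedDerivWithin 2 (fun t => threadingFlux u x₀ t x) (Set.Ici t₀) t₀ = 0) →
      IsNullProfile H₁ ∨ IsNullProfile H₂) :
    ∀ (t₀ T : ℝ) (u : ℝ → E3 → E3) (p : ℝ → E3 → ℝ) (x₀ a : E3) (Q : E3 →L[ℝ] E3) (H₁ H₂ : ℝ → ℝ),
      t₀ < T → Literature.Analysis.FluidPDE.IsClassicalNSSolutionOn (Set.Ico t₀ T) 1 0 u p → Tendsto (p t₀) (cocompact E3) (𝓝 0) →
      (∀ x : E3, ContDiffWithinAt ℝ 2 (fun t => threadingFlux u x₀ t x) (Set.Ici t₀) t₀) →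
      PairAdmissible H₁ H₂ a Q → ¬ IsCoaxial a Q → u t₀ = pairShell H₁ H₂ a Q x₀ → IsHelmholtzLinked H₁ H₂ →
      (∀ x : E3, iteratedDerivWithin 2 (fun t => threadingFlux u x₀ t x) (Set.Ici t₀) t₀ = 0) →
      IsNullProfile H₁ ∨ IsNullProfile H₂ := by
  intro t₀ T u p x₀ a Q H₁ H₂ hT hsol hp hcd hadm hnco hu hhl hj
  obtain ⟨c, hc⟩ := hhl
  by_cases hc0 : 0 ≤ c
  · exact Or.inl (isNullProfile_of_helmholtzLinked_nonneg hadm.2.2.1 hadm.2.2.2 hc0 hc).1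
  · exact hneg t₀ T u p x₀ a Q H₁ H₂ hT hsol hp hcd hadm hnco hu ⟨c, lt_of_not_ge hc0, hc⟩ hj

end Summit.NavierStokesRegularity.NavierStokesRegularity.Theorems.UnthreadedRigidity.MixedPair

end
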